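import Summits.QuantumFields.YangMills.Theorems.BalabanUVNodesN19TVCurrency
import Mathlib.MeasureTheory.Integral.Prod
import Mathlib.MeasureTheory.Integral.Pi

/-!
# BalabanUVNodes ∕ N19 — THE AFFINITY (HELLINGER ∕ LE CAM) CURRENCY, ONE CLASS AND INDEPENDENT BLOCKS, MEASURE LEVEL: two laws with densities
# `f, g` are `√(1 − A²)`-close on every set and `(1 − A)`-FAR on the Hahn set, `A = ∫ √(f g)`; over independent blocks `A` MULTIPLIES exactly
# (Kakutani), so product class laws are TV-far by `1 − ∏_b A_b` — the LOWER companion of the TV sub-additivity `Σ_b ρ_b`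

Cell `pub-ymgap` (HUMAN RULING D-0062 Track A ∕ D-0149 width seats), WIDTH SEAT `pub-ymgap-dag-n19-w2` (node n19 = NE7, seat 2 of 3), generation g5,
CLAIM-1 ∕ INTENT-2 path B (INBOX l.30368 ∕ l.30704).  Route `Summits/QuantumFields/YangMills/Theses/BalabanUVNodes.lean`, key item K3⁷ `SpineGivenEndpointR13SepCoPH`
(stmt-QuantumFields-20544); filed `--kind proof --supports … --as helper`.  COUNT-NEUTRAL.  THEOREMS ONLY (0 `def`, 0 `instance`, 0 `sorry`); imports dag-n19-c's
`…N19TVCurrency` (for the lane's letters; nothing of it is restated) and Mathlib's product ∕ finite-product integrals (`integral_prod_mul`,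
`integral_fintype_prod_eq_prod`); edits nothing, re-declares nothing.

WHY.  dag-n19-c (`…N19CoreTVInvariant` p504410): the observable-uniform invariant behind `Spine.NE7.Core` on common class spaces is MASS_cl ∧ TV_cl.  This seat's
g4 (`…N19TVProductBlocks` p606070, `…N19TVProductBlockFamily` p608519) composed TV_cl over INDEPENDENT BLOCKS from ABOVE: radii sub-add, `1 − ∏(1 − ρ_b) ≤ Σ ρ_b`,
sharp on two-point blocks.  The LOWER side — when are product class laws TV-FAR — is not a TV computation: total variation does not multiply.  The AFFINITY
`A = ∫ √(f g) dλ` (Bhattacharyya coefficient; `1 − A` = squared Hellinger distance) does (Kakutani), and Le Cam's two inequalities tie it to TV both ways.  This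
file is the measure-level half (densities `f, g` w.r.t. ONE reference measure `λ` — no loss: any two σ-finite laws have densities w.r.t. their sum); the
class-INDEX half and the binomial large-field-count caricature are this seat's `…N19AffinityClassIndexLaws` (p612301) ∕ `…LargeFieldCount(Iff)`; the discrete
tensorisation `bc_product` ∕ `bc_pi_ber` is checked in ym-nodeO idea-3 g10's crux sketch `Cruxes/…/HellingerRoadSketch.lean` §5 (not importable from here).

WHAT IS PROVED ([folklore]: Le Cam 1973; Kakutani 1948; e.g. Tsybakov 2009 Lemma 2.3, Ghosal–van der Vaart 2017 App. B; NO definition — `A` is SPELLED OUT).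
Densities: `f, g ≥ 0` measurable, integrable, `∫ f dλ = ∫ g dλ = 1`.
* §1 `integrable_sqrt_mul` · `affinity_nonneg` · `affinity_le_one` · `integral_sq_sqrt_sub_sqrt_eq` (`∫(√f − √g)² = 2 − 2A`) · `integral_sq_sqrt_add_sqrt_eq` ·
  ★ `two_mul_one_sub_affinity_le_integral_abs_sub` (Le Cam LOWER `2(1 − A) ≤ ∫|g − f|`) · ★ `integral_abs_sub_le_two_mul_sqrt` (Le Cam UPPER `∫|g − f| ≤ 2√(1 − A²)`,
  by `2|uv| ≤ t u² + v²∕t` at the optimal `t` — no Hölder machinery).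
* §2 set letters: `setIntegral_hahn_eq_half_integral_abs` (the Hahn set `{f < g}` carries half of `∫|g − f|`) · ★★ `exists_setIntegral_sub_ge_one_sub_affinity`
  (TV-FAR: a measurable `S` with `∫_S g − ∫_S f ≥ 1 − A`) · `abs_setIntegral_sub_le_half_integral_abs` · ★★ `abs_setIntegral_sub_le_sqrt_one_sub_affinity_sq`
  (TV-NEAR: every measurable `S` has `|∫_S g − ∫_S f| ≤ √(1 − A²)`) · `withDensity_real_eq_setIntegral` (dictionary to n19-c's `ν.real S` letters).
* §3 vs SHAPE, the intra-class small ∕ large-field HYBRID in affinity letters: ★ `exp_neg_half_mul_le_affinity_of_sandwichOn` (`e^{−r}·f ≤ g` on a set `G`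
  carrying `∫_G f ≥ 1 − ε` ⇒ `A ≥ e^{−r∕2}(1 − ε)` — a log-density sandwich on the SMALL-FIELD part and a mass bound on the rest is all the affinity asks).
* §4 independent blocks: ★★ `affinity_prod` (`A(f₁⊗f₂, g₁⊗g₂) = A₁·A₂` EXACTLY) · ★★ `affinity_pi` (`n` blocks: `∏_b A_b`) · `prod_le_exp_neg_sum_one_sub`
  (`∏ A_b ≤ e^{−Σ(1 − A_b)}`) · ★★ `exists_setIntegral_sub_ge_one_sub_prod_affinity` ∕ ★★ `exists_setIntegral_sub_ge_pi` (product class laws are TV-FAR by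
  `1 − A₁A₂`, resp. `1 − e^{−Σ_b(1 − A_b)}`: the LOWER companion of g4's `abs_pi_real_sub_pi_real_le_sum_of_tv`).
READING.  Over `vol` independent blocks the two-run class-law picture is two-sided: TV `≤ Σ_b ρ_b` (g4) and `≥ 1 − e^{−Σ_b H_b²}` (here, `H_b² = 1 − A_b`); for
RARE-event blocks `ρ_b ≍ H_b²` (both ≍ the block's event mass), so «TV-near» ⟺ «Σ_b H_b² small» ⟺ «Σ_b ρ_b small» — ONE extensive letter decides, and the
square root in Le Cam's upper inequality is never paid blockwise.

HONEST FRAMING.  [folklore] measure ∕ real arithmetic on hypothesis SHAPES (densities, blocks are HYPOTHESES); NO estimate of the programme is proved; nothing of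
Bałaban's is asserted or instantiated; NE7 ∕ NE1′ NOT PRINTED as two-run statements for d = 4 and NOT proved; N19 NOT discharged; K3⁷ OPEN, not claimed, v5
untouched; no summit statement is proved by this seat; counts UNMOVED (typed 28∕28 · discharged 5∕27, A 5∕28).  One finite four-torus programme at fixed ε — NOT
ℝ⁴, NOT infinite volume, NOT OS, NOT a mass gap, NOT the Clay problem (R4 closes the conditional finite-𝕋⁴ rung `BalabanLadder.UV` only).  0 `def`; 0 `sorry`.
-/

set_option autoImplicit false

noncomputable section

open MeasureTheory
open scoped ENNReal

namespace Summit.QuantumFields.YangMills.BalabanUVNodes.N19AffinityCurrency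

/-! ## §1 Le Cam's two inequalities for two probability densities [folklore] -/

section OneClass

variable {α : Type*} [MeasurableSpace α] {μ : Measure α} {f g : α → ℝ}

/-- `√(f g)` is integrable (dominated by `(f + g)∕2`). [folklore] -/
theorem integrable_sqrt_mul (hf : Measurable f) (hg : Measurable g) (hf0 : ∀ x, 0 ≤ f x) (hg0 : ∀ x, 0 ≤ g x)
    (hfi : Integrable f μ) (hgi : Integrable g μ) : Integrable (fun x => Real.sqrt (f x * g x)) μ := by
  refine Integrable.mono' ((hfi.add hgi).div_const 2) (hf.mul hg).sqrt.aestronglyMeasurable (ae_of_all _ fun x => ?_)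
  rw [Real.norm_eq_abs, abs_of_nonneg (Real.sqrt_nonneg _), Real.sqrt_mul (hf0 x)]
  simp only [Pi.add_apply]
  nlinarith [sq_nonneg (Real.sqrt (f x) - Real.sqrt (g x)), Real.sq_sqrt (hf0 x), Real.sq_sqrt (hg0 x)]

/-- `0 ≤ A = ∫ √(f g)`. [folklore] -/
theorem affinity_nonneg : 0 ≤ ∫ x, Real.sqrt (f x * g x) ∂μ :=
  integral_nonneg fun _ => Real.sqrt_nonneg _

omit [MeasurableSpace α] in
/-- `(√f − √g)²` and `(√f + √g)²` expand with `√f·√g = √(fg)`. [folklore] -/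
theorem sq_sqrt_sub_sqrt_eq (x : α) (hf0 : ∀ x, 0 ≤ f x) (hg0 : ∀ x, 0 ≤ g x) :
    (Real.sqrt (f x) - Real.sqrt (g x)) ^ 2 = f x + g x - 2 * Real.sqrt (f x * g x) ∧
      (Real.sqrt (f x) + Real.sqrt (g x)) ^ 2 = f x + g x + 2 * Real.sqrt (f x * g x) := by
  rw [sub_sq, add_sq, Real.sq_sqrt (hf0 x), Real.sq_sqrt (hg0 x), Real.sqrt_mul (hf0 x)]
  constructor <;> ring

/-- `∫ (√f − √g)² = 2 − 2A` (twice the squared Hellinger distance). [folklore] -/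
theorem integral_sq_sqrt_sub_sqrt_eq (hf : Measurable f) (hg : Measurable g) (hf0 : ∀ x, 0 ≤ f x) (hg0 : ∀ x, 0 ≤ g x)
    (hfi : Integrable f μ) (hgi : Integrable g μ) (hf1 : ∫ x, f x ∂μ = 1) (hg1 : ∫ x, g x ∂μ = 1) :
    ∫ x, (Real.sqrt (f x) - Real.sqrt (g x)) ^ 2 ∂μ = 2 - 2 * ∫ x, Real.sqrt (f x * g x) ∂μ := by
  have h : (fun x => (Real.sqrt (f x) - Real.sqrt (g x)) ^ 2) = fun x => (f x + g x) - 2 * Real.sqrt (f x * g x) :=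
    funext fun x => (sq_sqrt_sub_sqrt_eq x hf0 hg0).1
  rw [h, integral_sub (show Integrable (fun x => f x + g x) μ from hfi.add hgi)
    ((integrable_sqrt_mul hf hg hf0 hg0 hfi hgi).const_mul 2), integral_add hfi hgi, integral_const_mul, hf1, hg1]
  ring

/-- `∫ (√f + √g)² = 2 + 2A`. [folklore] -/
theorem integral_sq_sqrt_add_sqrt_eq (hf : Measurable f) (hg : Measurable g) (hf0 : ∀ x, 0 ≤ f x) (hg0 : ∀ x, 0 ≤ g x)
    (hfi : Integrable f μ) (hgi : Integrable g μ) (hf1 : ∫ x, f x ∂μ = 1) (hg1 : ∫ x, g x ∂μ = 1) :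
    ∫ x, (Real.sqrt (f x) + Real.sqrt (g x)) ^ 2 ∂μ = 2 + 2 * ∫ x, Real.sqrt (f x * g x) ∂μ := by
  have h : (fun x => (Real.sqrt (f x) + Real.sqrt (g x)) ^ 2) = fun x => (f x + g x) + 2 * Real.sqrt (f x * g x) :=
    funext fun x => (sq_sqrt_sub_sqrt_eq x hf0 hg0).2
  rw [h, integral_add (show Integrable (fun x => f x + g x) μ from hfi.add hgi)
    ((integrable_sqrt_mul hf hg hf0 hg0 hfi hgi).const_mul 2), integral_add hfi hgi, integral_const_mul, hf1, hg1]
  ring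

/-- `A ≤ 1` for two probability densities. [folklore] -/
theorem affinity_le_one (hf : Measurable f) (hg : Measurable g) (hf0 : ∀ x, 0 ≤ f x) (hg0 : ∀ x, 0 ≤ g x)
    (hfi : Integrable f μ) (hgi : Integrable g μ) (hf1 : ∫ x, f x ∂μ = 1) (hg1 : ∫ x, g x ∂μ = 1) :
    ∫ x, Real.sqrt (f x * g x) ∂μ ≤ 1 := by
  have h := integral_sq_sqrt_sub_sqrt_eq hf hg hf0 hg0 hfi hgi hf1 hg1
  have h0 : 0 ≤ ∫ x, (Real.sqrt (f x) - Real.sqrt (g x)) ^ 2 ∂μ := integral_nonneg fun _ => sq_nonneg _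
  linarith

omit [MeasurableSpace α] in
/-- `|g − f| = |√f − √g|·(√f + √g)` pointwise and `(√f − √g)² ≤ |g − f|` (the tree's `Literature.Analysis.FunctionSpaces.sq_sqrt_sub_sqrt_le`,
re-derived pointwise to keep the imports local). [folklore] -/
theorem abs_sub_sqrt_letters (x : α) (hf0 : ∀ x, 0 ≤ f x) (hg0 : ∀ x, 0 ≤ g x) :
    |g x - f x| = |Real.sqrt (f x) - Real.sqrt (g x)| * (Real.sqrt (f x) + Real.sqrt (g x)) ∧
      (Real.sqrt (f x) - Real.sqrt (g x)) ^ 2 ≤ |g x - f x| := by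
  have hff : Real.sqrt (f x) * Real.sqrt (f x) = f x := Real.mul_self_sqrt (hf0 x)
  have hgg : Real.sqrt (g x) * Real.sqrt (g x) = g x := Real.mul_self_sqrt (hg0 x)
  have hprod : (Real.sqrt (f x) - Real.sqrt (g x)) * (Real.sqrt (f x) + Real.sqrt (g x)) = f x - g x := by
    calc (Real.sqrt (f x) - Real.sqrt (g x)) * (Real.sqrt (f x) + Real.sqrt (g x))
        = Real.sqrt (f x) * Real.sqrt (f x) - Real.sqrt (g x) * Real.sqrt (g x) := by ring
      _ = f x - g x := by rw [hff, hgg]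
  constructor
  · rw [abs_sub_comm, ← hprod, abs_mul, abs_of_nonneg (add_nonneg (Real.sqrt_nonneg _) (Real.sqrt_nonneg _))]
  · rcases le_total (f x) (g x) with hle | hle
    · have hs : Real.sqrt (f x) * Real.sqrt (f x) ≤ Real.sqrt (f x) * Real.sqrt (g x) :=
        mul_le_mul_of_nonneg_left (Real.sqrt_le_sqrt hle) (Real.sqrt_nonneg _)
      rw [abs_of_nonneg (sub_nonneg.2 hle)]
      nlinarith
    · have hs : Real.sqrt (g x) * Real.sqrt (g x) ≤ Real.sqrt (g x) * Real.sqrt (f x) :=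
        mul_le_mul_of_nonneg_left (Real.sqrt_le_sqrt hle) (Real.sqrt_nonneg _)
      rw [abs_of_nonpos (sub_nonpos.2 hle)]
      nlinarith

/-- ★ **LE CAM, LOWER**: `2(1 − A) ≤ ∫ |g − f|`. [folklore] -/
theorem two_mul_one_sub_affinity_le_integral_abs_sub (hf : Measurable f) (hg : Measurable g) (hf0 : ∀ x, 0 ≤ f x)
    (hg0 : ∀ x, 0 ≤ g x) (hfi : Integrable f μ) (hgi : Integrable g μ) (hf1 : ∫ x, f x ∂μ = 1) (hg1 : ∫ x, g x ∂μ = 1) :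
    2 * (1 - ∫ x, Real.sqrt (f x * g x) ∂μ) ≤ ∫ x, |g x - f x| ∂μ := by
  have h := integral_sq_sqrt_sub_sqrt_eq hf hg hf0 hg0 hfi hgi hf1 hg1
  have hsqi : Integrable (fun x => (Real.sqrt (f x) - Real.sqrt (g x)) ^ 2) μ := by
    have h' : (fun x => (Real.sqrt (f x) - Real.sqrt (g x)) ^ 2) = fun x => (f x + g x) - 2 * Real.sqrt (f x * g x) :=
      funext fun x => (sq_sqrt_sub_sqrt_eq x hf0 hg0).1
    rw [h']
    exact (hfi.add hgi).sub ((integrable_sqrt_mul hf hg hf0 hg0 hfi hgi).const_mul 2)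
  calc 2 * (1 - ∫ x, Real.sqrt (f x * g x) ∂μ) = ∫ x, (Real.sqrt (f x) - Real.sqrt (g x)) ^ 2 ∂μ := by rw [h]; ring
    _ ≤ ∫ x, |g x - f x| ∂μ := integral_mono hsqi (hgi.sub hfi).abs fun x => (abs_sub_sqrt_letters x hf0 hg0).2

/-- ★ **LE CAM, UPPER**: `∫ |g − f| ≤ 2√(1 − A²)` — from `|g − f| = |√f − √g|(√f + √g) ≤ (t(√f − √g)² + (√f + √g)²∕t)∕2` integrated at the optimal
`t = √((1 + A)∕(1 − A))` (the degenerate `A = 1` handled by `t → ∞`). [folklore] -/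
theorem integral_abs_sub_le_two_mul_sqrt (hf : Measurable f) (hg : Measurable g) (hf0 : ∀ x, 0 ≤ f x) (hg0 : ∀ x, 0 ≤ g x)
    (hfi : Integrable f μ) (hgi : Integrable g μ) (hf1 : ∫ x, f x ∂μ = 1) (hg1 : ∫ x, g x ∂μ = 1) :
    ∫ x, |g x - f x| ∂μ ≤ 2 * Real.sqrt (1 - (∫ x, Real.sqrt (f x * g x) ∂μ) ^ 2) := by
  set A := ∫ x, Real.sqrt (f x * g x) ∂μ with hA
  have hA0 : 0 ≤ A := affinity_nonneg
  have hA1 : A ≤ 1 := affinity_le_one hf hg hf0 hg0 hfi hgi hf1 hg1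
  have hm := integral_sq_sqrt_sub_sqrt_eq hf hg hf0 hg0 hfi hgi hf1 hg1
  have hp := integral_sq_sqrt_add_sqrt_eq hf hg hf0 hg0 hfi hgi hf1 hg1
  have hsq := integrable_sqrt_mul hf hg hf0 hg0 hfi hgi
  have hmi : Integrable (fun x => (Real.sqrt (f x) - Real.sqrt (g x)) ^ 2) μ := by
    have h' : (fun x => (Real.sqrt (f x) - Real.sqrt (g x)) ^ 2) = fun x => (f x + g x) - 2 * Real.sqrt (f x * g x) :=
      funext fun x => (sq_sqrt_sub_sqrt_eq x hf0 hg0).1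
    rw [h']; exact (hfi.add hgi).sub (hsq.const_mul 2)
  have hpi : Integrable (fun x => (Real.sqrt (f x) + Real.sqrt (g x)) ^ 2) μ := by
    have h' : (fun x => (Real.sqrt (f x) + Real.sqrt (g x)) ^ 2) = fun x => (f x + g x) + 2 * Real.sqrt (f x * g x) :=
      funext fun x => (sq_sqrt_sub_sqrt_eq x hf0 hg0).2
    rw [h']; exact (hfi.add hgi).add (hsq.const_mul 2)
  -- for every `t > 0`: `∫|g − f| ≤ t(1 − A) + (1 + A)∕t`
  have hstep : ∀ t : ℝ, 0 < t → ∫ x, |g x - f x| ∂μ ≤ t * (1 - A) + (1 + A) / t := by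
    intro t ht
    have hpt : ∀ x, |g x - f x| ≤ (t * (Real.sqrt (f x) - Real.sqrt (g x)) ^ 2 + (Real.sqrt (f x) + Real.sqrt (g x)) ^ 2 / t) / 2 := by
      intro x
      rw [(abs_sub_sqrt_letters x hf0 hg0).1]
      set u := |Real.sqrt (f x) - Real.sqrt (g x)|
      set v := Real.sqrt (f x) + Real.sqrt (g x)
      have hu2 : u ^ 2 = (Real.sqrt (f x) - Real.sqrt (g x)) ^ 2 := sq_abs _
      rw [← hu2]
      have key : 0 ≤ (t * u - v) ^ 2 / t := div_nonneg (sq_nonneg _) ht.le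
      have expand : (t * u - v) ^ 2 / t = t * u ^ 2 - 2 * (u * v) + v ^ 2 / t := by
        field_simp
        ring
      linarith [expand ▸ key]
    calc ∫ x, |g x - f x| ∂μ
        ≤ ∫ x, (t * (Real.sqrt (f x) - Real.sqrt (g x)) ^ 2 + (Real.sqrt (f x) + Real.sqrt (g x)) ^ 2 / t) / 2 ∂μ :=
          integral_mono (hgi.sub hfi).abs (((hmi.const_mul t).add (hpi.div_const t)).div_const 2) hpt
      _ = (t * (2 - 2 * A) + (2 + 2 * A) / t) / 2 := by
          rw [integral_div, integral_add (hmi.const_mul t) (hpi.div_const t), integral_const_mul, integral_div, hm, hp]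
      _ = t * (1 - A) + (1 + A) / t := by ring
  rcases hA1.eq_or_lt with hA1' | hAlt
  · -- `A = 1`: `∫|g − f| ≤ 2∕t` for every `t > 0`, hence `≤ 0`
    rw [hA1']
    have hle : ∫ x, |g x - f x| ∂μ ≤ 0 := by
      by_contra hcon
      rw [not_le] at hcon
      have := hstep (4 / ∫ x, |g x - f x| ∂μ) (by positivity)
      rw [hA1'] at this
      have h4 : (1 + 1) / (4 / ∫ x, |g x - f x| ∂μ) = (∫ x, |g x - f x| ∂μ) / 2 := by
        rw [div_div_eq_mul_div]; ring
      rw [sub_self, mul_zero, zero_add, h4] at this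
      linarith
    simpa using hle
  · -- `A < 1`: the optimal `t`
    have h1A : 0 < 1 - A := sub_pos.2 hAlt
    set t := Real.sqrt ((1 + A) / (1 - A)) with ht
    have htpos : 0 < t := Real.sqrt_pos.2 (div_pos (by linarith) h1A)
    have ht2 : t ^ 2 = (1 + A) / (1 - A) := Real.sq_sqrt (div_nonneg (by linarith) h1A.le)
    have hmain := hstep t htpos
    -- `t(1 − A) = (1 + A)∕t = √((1 − A)(1 + A))`
    have hts : t ^ 2 * (1 - A) = 1 + A := by rw [ht2, div_mul_cancel₀ _ h1A.ne']
    have hprod : t * (1 - A) = (1 + A) / t := by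
      rw [eq_div_iff htpos.ne', ← hts]
      ring
    have hroot : (t * (1 - A)) ^ 2 = 1 - A ^ 2 := by
      calc (t * (1 - A)) ^ 2 = t ^ 2 * (1 - A) * (1 - A) := by ring
        _ = (1 + A) * (1 - A) := by rw [hts]
        _ = 1 - A ^ 2 := by ring
    have hsqrt : t * (1 - A) = Real.sqrt (1 - A ^ 2) := by
      rw [← hroot, Real.sqrt_sq (mul_nonneg htpos.le h1A.le)]
    linarith [hmain, hprod, hsqrt]

/-! ## §2 Set letters: the Hahn set is far, every set is near [folklore] -/

/-- The HAHN SET `{f < g}` carries exactly half of `∫|g − f|` when the totals agree. [folklore] -/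
theorem setIntegral_hahn_eq_half_integral_abs (hf : Measurable f) (hg : Measurable g) (hfi : Integrable f μ)
    (hgi : Integrable g μ) (hfg : ∫ x, f x ∂μ = ∫ x, g x ∂μ) :
    ∫ x in {x | f x < g x}, (g x - f x) ∂μ = (∫ x, |g x - f x| ∂μ) / 2 := by
  have hS : MeasurableSet {x | f x < g x} := measurableSet_lt hf hg
  have hint : Integrable (fun x => g x - f x) μ := hgi.sub hfi
  have h0 : ∫ x, (g x - f x) ∂μ = 0 := by rw [integral_sub hgi hfi, hfg, sub_self]
  have hsplit := integral_add_compl hS hint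
  have hsplitabs := integral_add_compl hS hint.abs
  have hS1 : ∫ x in {x | f x < g x}, |g x - f x| ∂μ = ∫ x in {x | f x < g x}, (g x - f x) ∂μ :=
    setIntegral_congr_fun hS fun x hx => abs_of_pos (sub_pos.2 hx)
  have hS2 : ∫ x in {x | f x < g x}ᶜ, |g x - f x| ∂μ = -∫ x in {x | f x < g x}ᶜ, (g x - f x) ∂μ := by
    rw [← integral_neg]
    exact setIntegral_congr_fun hS.compl fun x hx => by
      have hx' : ¬ f x < g x := hx
      rw [abs_of_nonpos (sub_nonpos.2 (not_lt.1 hx'))]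
  linarith

/-- ★★ **TV-FAR WHEN THE AFFINITY IS SMALL**: some measurable set (the Hahn set) separates the two laws by at least `1 − A`. [folklore] -/
theorem exists_setIntegral_sub_ge_one_sub_affinity (hf : Measurable f) (hg : Measurable g) (hf0 : ∀ x, 0 ≤ f x)
    (hg0 : ∀ x, 0 ≤ g x) (hfi : Integrable f μ) (hgi : Integrable g μ) (hf1 : ∫ x, f x ∂μ = 1) (hg1 : ∫ x, g x ∂μ = 1) :
    ∃ S : Set α, MeasurableSet S ∧
      1 - ∫ x, Real.sqrt (f x * g x) ∂μ ≤ ∫ x in S, g x ∂μ - ∫ x in S, f x ∂μ := by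
  refine ⟨{x | f x < g x}, measurableSet_lt hf hg, ?_⟩
  rw [← integral_sub hgi.integrableOn hfi.integrableOn,
    setIntegral_hahn_eq_half_integral_abs hf hg hfi hgi (hf1.trans hg1.symm)]
  have h := two_mul_one_sub_affinity_le_integral_abs_sub hf hg hf0 hg0 hfi hgi hf1 hg1
  linarith

/-- Every measurable `S`: `|∫_S g − ∫_S f| ≤ ½∫|g − f|` when the totals agree (`S` and `Sᶜ` carry opposite differences). [folklore] -/
theorem abs_setIntegral_sub_le_half_integral_abs (hfi : Integrable f μ) (hgi : Integrable g μ)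
    (hfg : ∫ x, f x ∂μ = ∫ x, g x ∂μ) {S : Set α} (hS : MeasurableSet S) :
    |∫ x in S, g x ∂μ - ∫ x in S, f x ∂μ| ≤ (∫ x, |g x - f x| ∂μ) / 2 := by
  have hint : Integrable (fun x => g x - f x) μ := hgi.sub hfi
  rw [← integral_sub hgi.integrableOn hfi.integrableOn]
  have h0 : ∫ x, (g x - f x) ∂μ = 0 := by rw [integral_sub hgi hfi, hfg, sub_self]
  have hsplit := integral_add_compl hS hint
  have hsplitabs := integral_add_compl hS hint.abs
  have h1 : |∫ x in S, (g x - f x) ∂μ| ≤ ∫ x in S, |g x - f x| ∂μ := abs_integral_le_integral_abs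
  have h2 : |∫ x in Sᶜ, (g x - f x) ∂μ| ≤ ∫ x in Sᶜ, |g x - f x| ∂μ := abs_integral_le_integral_abs
  have h3 : ∫ x in Sᶜ, (g x - f x) ∂μ = -∫ x in S, (g x - f x) ∂μ := by linarith
  rw [h3, abs_neg] at h2
  linarith

/-- ★★ **TV-NEAR WHEN THE AFFINITY IS NEAR ONE**: every measurable set has `|∫_S g − ∫_S f| ≤ √(1 − A²)`. [folklore] -/
theorem abs_setIntegral_sub_le_sqrt_one_sub_affinity_sq (hf : Measurable f) (hg : Measurable g) (hf0 : ∀ x, 0 ≤ f x)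
    (hg0 : ∀ x, 0 ≤ g x) (hfi : Integrable f μ) (hgi : Integrable g μ) (hf1 : ∫ x, f x ∂μ = 1) (hg1 : ∫ x, g x ∂μ = 1)
    {S : Set α} (hS : MeasurableSet S) :
    |∫ x in S, g x ∂μ - ∫ x in S, f x ∂μ| ≤ Real.sqrt (1 - (∫ x, Real.sqrt (f x * g x) ∂μ) ^ 2) := by
  have h1 := abs_setIntegral_sub_le_half_integral_abs hfi hgi (hf1.trans hg1.symm) hS
  have h2 := integral_abs_sub_le_two_mul_sqrt hf hg hf0 hg0 hfi hgi hf1 hg1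
  linarith

/-- Dictionary to n19-c's set letters: the law with density `f` gives the set `S` the real mass `∫_S f`. [folklore] -/
theorem withDensity_real_eq_setIntegral (hf0 : ∀ x, 0 ≤ f x) (hfi : Integrable f μ) {S : Set α}
    (hS : MeasurableSet S) :
    (μ.withDensity fun x => ENNReal.ofReal (f x)).real S = ∫ x in S, f x ∂μ := by
  rw [measureReal_def, withDensity_apply _ hS,
    ← ofReal_integral_eq_lintegral_ofReal hfi.integrableOn (ae_of_all _ fun x => hf0 x),
    ENNReal.toReal_ofReal (setIntegral_nonneg hS fun x _ => hf0 x)]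

/-! ## §3 Versus SHAPE: a log-density sandwich on the small-field part and a mass bound on the rest bound the affinity from below -/

/-- ★ **THE INTRA-CLASS SMALL ∕ LARGE-FIELD HYBRID IN AFFINITY LETTERS.**  If `e^{−r}·f ≤ g` on a measurable set `G` (a one-sided log-density
sandwich on the «small-field» part) and `∫_G f ≥ 1 − ε` (the rest is rare under run A), then `A ≥ e^{−r∕2}(1 − ε)`: the affinity asks nothing
about the two laws off `G`. [folklore] -/
theorem exp_neg_half_mul_le_affinity_of_sandwichOn (hf : Measurable f) (hg : Measurable g) (hf0 : ∀ x, 0 ≤ f x)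
    (hg0 : ∀ x, 0 ≤ g x) (hfi : Integrable f μ) (hgi : Integrable g μ) {G : Set α} (hG : MeasurableSet G) {r ε : ℝ}
    (hsand : ∀ x ∈ G, Real.exp (-r) * f x ≤ g x) (hmass : 1 - ε ≤ ∫ x in G, f x ∂μ) :
    Real.exp (-(r / 2)) * (1 - ε) ≤ ∫ x, Real.sqrt (f x * g x) ∂μ := by
  have hsq := integrable_sqrt_mul hf hg hf0 hg0 hfi hgi
  have he : Real.exp (-(r / 2)) * Real.exp (-(r / 2)) = Real.exp (-r) := by
    rw [← Real.exp_add]; ring_nf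
  have hpt : ∀ x ∈ G, Real.exp (-(r / 2)) * f x ≤ Real.sqrt (f x * g x) := fun x hx => by
    have h1 : f x * (Real.exp (-r) * f x) ≤ f x * g x := mul_le_mul_of_nonneg_left (hsand x hx) (hf0 x)
    have h2 : Real.sqrt (f x * (Real.exp (-r) * f x)) = Real.exp (-(r / 2)) * f x := by
      rw [show f x * (Real.exp (-r) * f x) = (Real.exp (-(r / 2)) * f x) ^ 2 by rw [← he]; ring]
      exact Real.sqrt_sq (mul_nonneg (Real.exp_pos _).le (hf0 x))
    rw [← h2]
    exact Real.sqrt_le_sqrt h1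
  calc Real.exp (-(r / 2)) * (1 - ε) ≤ Real.exp (-(r / 2)) * ∫ x in G, f x ∂μ :=
        mul_le_mul_of_nonneg_left hmass (Real.exp_pos _).le
    _ = ∫ x in G, Real.exp (-(r / 2)) * f x ∂μ := (integral_const_mul _ _).symm
    _ ≤ ∫ x in G, Real.sqrt (f x * g x) ∂μ :=
        setIntegral_mono_on (hfi.const_mul _).integrableOn hsq.integrableOn hG hpt
    _ ≤ ∫ x, Real.sqrt (f x * g x) ∂μ := setIntegral_le_integral hsq (ae_of_all _ fun x => Real.sqrt_nonneg _)

end OneClass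

/-! ## §4 Independent blocks: the affinity MULTIPLIES (Kakutani), so product class laws are TV-far by `1 − ∏ A_b` [folklore] -/

section TwoBlocks

variable {X Y : Type*} [MeasurableSpace X] [MeasurableSpace Y] {μ₁ : Measure X} {μ₂ : Measure Y} [SFinite μ₁] [SFinite μ₂]
  {f₁ g₁ : X → ℝ} {f₂ g₂ : Y → ℝ}

/-- ★★ **KAKUTANI: the affinity of product densities is the product of the affinities** (`integral_prod_mul`). [folklore] -/
theorem affinity_prod (hf₁0 : ∀ x, 0 ≤ f₁ x) (hg₁0 : ∀ x, 0 ≤ g₁ x) :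
    ∫ z, Real.sqrt ((f₁ z.1 * f₂ z.2) * (g₁ z.1 * g₂ z.2)) ∂(μ₁.prod μ₂) =
      (∫ x, Real.sqrt (f₁ x * g₁ x) ∂μ₁) * ∫ y, Real.sqrt (f₂ y * g₂ y) ∂μ₂ := by
  rw [← integral_prod_mul]
  refine integral_congr_ae (ae_of_all _ fun z => ?_)
  show Real.sqrt ((f₁ z.1 * f₂ z.2) * (g₁ z.1 * g₂ z.2)) = Real.sqrt (f₁ z.1 * g₁ z.1) * Real.sqrt (f₂ z.2 * g₂ z.2)
  rw [show f₁ z.1 * f₂ z.2 * (g₁ z.1 * g₂ z.2) = (f₁ z.1 * g₁ z.1) * (f₂ z.2 * g₂ z.2) by ring,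
    Real.sqrt_mul (mul_nonneg (hf₁0 _) (hg₁0 _))]

/-- ★★ **PRODUCT CLASS LAWS ARE TV-FAR BY `1 − A₁A₂`**: two independent blocks with blockwise densities `(f₁, g₁)`, `(f₂, g₂)`; some measurable
`S ⊆ X × Y` separates the product laws by `≥ 1 − A₁·A₂` — the LOWER companion of g4's `abs_prod_real_sub_prod_real_le_of_tv`. [folklore] -/
theorem exists_setIntegral_sub_ge_one_sub_prod_affinity (hf₁ : Measurable f₁) (hg₁ : Measurable g₁) (hf₂ : Measurable f₂)
    (hg₂ : Measurable g₂) (hf₁0 : ∀ x, 0 ≤ f₁ x) (hg₁0 : ∀ x, 0 ≤ g₁ x) (hf₂0 : ∀ y, 0 ≤ f₂ y) (hg₂0 : ∀ y, 0 ≤ g₂ y)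
    (hf₁i : Integrable f₁ μ₁) (hg₁i : Integrable g₁ μ₁) (hf₂i : Integrable f₂ μ₂) (hg₂i : Integrable g₂ μ₂)
    (hf₁1 : ∫ x, f₁ x ∂μ₁ = 1) (hg₁1 : ∫ x, g₁ x ∂μ₁ = 1) (hf₂1 : ∫ y, f₂ y ∂μ₂ = 1) (hg₂1 : ∫ y, g₂ y ∂μ₂ = 1) :
    ∃ S : Set (X × Y), MeasurableSet S ∧
      1 - (∫ x, Real.sqrt (f₁ x * g₁ x) ∂μ₁) * (∫ y, Real.sqrt (f₂ y * g₂ y) ∂μ₂) ≤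
        ∫ z in S, g₁ z.1 * g₂ z.2 ∂(μ₁.prod μ₂) - ∫ z in S, f₁ z.1 * f₂ z.2 ∂(μ₁.prod μ₂) := by
  rw [← affinity_prod hf₁0 hg₁0]
  exact exists_setIntegral_sub_ge_one_sub_affinity (μ := μ₁.prod μ₂) (f := fun z => f₁ z.1 * f₂ z.2)
    (g := fun z => g₁ z.1 * g₂ z.2)
    ((hf₁.comp measurable_fst).mul (hf₂.comp measurable_snd)) ((hg₁.comp measurable_fst).mul (hg₂.comp measurable_snd))
    (fun z => mul_nonneg (hf₁0 _) (hf₂0 _)) (fun z => mul_nonneg (hg₁0 _) (hg₂0 _))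
    (hf₁i.mul_prod hf₂i) (hg₁i.mul_prod hg₂i)
    (by rw [integral_prod_mul, hf₁1, hf₂1, mul_one]) (by rw [integral_prod_mul, hg₁1, hg₂1, mul_one])

end TwoBlocks

section Blocks

variable {ι : Type*} [Fintype ι] {E : Type*} [MeasurableSpace E] {μ : ι → Measure E} [∀ i, SigmaFinite (μ i)]
  {f g : ι → E → ℝ}

/-- ★★ **`n` BLOCKS: the affinity of the product densities is `∏_b A_b`** (`integral_fintype_prod_eq_prod`). [folklore] -/
theorem affinity_pi (hf0 : ∀ i x, 0 ≤ f i x) (hg0 : ∀ i x, 0 ≤ g i x) :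
    ∫ x, Real.sqrt ((∏ i, f i (x i)) * ∏ i, g i (x i)) ∂(Measure.pi μ) = ∏ i, ∫ y, Real.sqrt (f i y * g i y) ∂(μ i) := by
  rw [← integral_fintype_prod_eq_prod]
  refine integral_congr_ae (ae_of_all _ fun x => ?_)
  show Real.sqrt ((∏ i, f i (x i)) * ∏ i, g i (x i)) = ∏ i, Real.sqrt (f i (x i) * g i (x i))
  rw [← Finset.prod_mul_distrib, Real.sqrt_prod _ fun i _ => mul_nonneg (hf0 i _) (hg0 i _)]

omit [Fintype ι] in
/-- `∏_b A_b ≤ e^{−Σ_b (1 − A_b)}` for `A_b ≥ 0` (`A ≤ e^{A − 1}` blockwise). [folklore] -/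
theorem prod_le_exp_neg_sum_one_sub (s : Finset ι) {A : ι → ℝ} (hA : ∀ i ∈ s, 0 ≤ A i) :
    ∏ i ∈ s, A i ≤ Real.exp (-∑ i ∈ s, (1 - A i)) := by
  rw [← Finset.sum_neg_distrib, Real.exp_sum]
  exact Finset.prod_le_prod hA fun i _ => by
    have h := Real.add_one_le_exp (-(1 - A i))
    linarith

/-- ★★ **`n`-BLOCK CLASS LAWS ARE TV-FAR BY `1 − e^{−Σ_b (1 − A_b)}`**: with `Σ_b H_b² = Σ_b (1 − A_b)` the total squared Hellinger budget of the
blocks, some measurable set separates the two product laws by `≥ 1 − e^{−Σ_b H_b²}` — the LOWER companion of g4's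
`abs_pi_real_sub_pi_real_le_sum_of_tv` (`≤ Σ_b ρ_b`): over `vol` blocks one extensive letter decides near ∕ far. [folklore] -/
theorem exists_setIntegral_sub_ge_pi (hf : ∀ i, Measurable (f i)) (hg : ∀ i, Measurable (g i)) (hf0 : ∀ i x, 0 ≤ f i x)
    (hg0 : ∀ i x, 0 ≤ g i x) (hfi : ∀ i, Integrable (f i) (μ i)) (hgi : ∀ i, Integrable (g i) (μ i))
    (hf1 : ∀ i, ∫ y, f i y ∂(μ i) = 1) (hg1 : ∀ i, ∫ y, g i y ∂(μ i) = 1) :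
    ∃ S : Set (ι → E), MeasurableSet S ∧
      1 - Real.exp (-∑ i, (1 - ∫ y, Real.sqrt (f i y * g i y) ∂(μ i))) ≤
        ∫ x in S, (∏ i, g i (x i)) ∂(Measure.pi μ) - ∫ x in S, (∏ i, f i (x i)) ∂(Measure.pi μ) := by
  obtain ⟨S, hS, h⟩ := exists_setIntegral_sub_ge_one_sub_affinity (μ := Measure.pi μ) (f := fun x => ∏ i, f i (x i))
    (g := fun x => ∏ i, g i (x i))
    (Finset.measurable_prod _ fun i _ => (hf i).comp (measurable_pi_apply i))
    (Finset.measurable_prod _ fun i _ => (hg i).comp (measurable_pi_apply i))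
    (fun x => Finset.prod_nonneg fun i _ => hf0 i _) (fun x => Finset.prod_nonneg fun i _ => hg0 i _)
    (Integrable.fintype_prod hfi) (Integrable.fintype_prod hgi)
    (by rw [integral_fintype_prod_eq_prod]; exact Finset.prod_eq_one fun i _ => hf1 i)
    (by rw [integral_fintype_prod_eq_prod]; exact Finset.prod_eq_one fun i _ => hg1 i)
  refine ⟨S, hS, le_trans ?_ h⟩
  rw [affinity_pi hf0 hg0]
  have hprod := prod_le_exp_neg_sum_one_sub Finset.univ
    (fun i _ => (affinity_nonneg (μ := μ i) (f := f i) (g := g i)))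
  linarith

end Blocks

end Summit.QuantumFields.YangMills.BalabanUVNodes.N19AffinityCurrency

end
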